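import Summits.BirchSwinnertonDyer.BirchSwinnertonDyer.Theorems.Rank1ResidualJetCarrierAddEndForm
import Summits.BirchSwinnertonDyer.BirchSwinnertonDyer.Theorems.Rank1ResidualJetKodairaNeronCyclic
import Summits.BirchSwinnertonDyer.BirchSwinnertonDyer.Theorems.Rank1ResidualJetTransverseConj
import Summits.BirchSwinnertonDyer.BirchSwinnertonDyer.Theorems.Rank1ResidualJetTransverseClass
import HarnessLib

/-!
# T1 JET (cell `bsd-jet`), road K — the END FORMS with three binders DISCHARGED: K3 / K1 / K4 from
# named print + `hloc`, `h𝒯sd` + the ONE remaining completion-layer gap `h49str`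

HONEST FRAMING (programme file §HONESTY, verbatim): «no tranche here proves BSD; ARM L moves the
LITERAL column of an r ≤ 1 census into the kernel-proved-modulo-named-print column.» THEOREMS ONLY
(seat `bsd-jet-pv-2`, session g5; `--supports stmt-BirchSwinnertonDyer-14418`, helper); 0 classes
move; K1/K3/K4 stay `@[conjecture]`. WHAT THIS IS. The END FORMS of session g4
(`JET.jetchevDivisibilityCarrier{Mult,Ne,Add}_of_localFacts`, p517079 / p517404 / p517696) reduce the
reading binders K3 / K1 / K4 (Jetchev 2008 Thm. 1.4 read at `p ∣ N`) to CLOSED statements. Three of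
them are now THEOREMS of the tree and are discharged here, everything else byte-identical:
* `hΦ` (Kodaira–Néron row datum) := `kodairaNeron_isAddCyclic_forall` (p520826);
* `h𝒯σ` (τ-stability of the intrinsic transverse family) := `conjActPlace_mem_transverseFamily_forall`
  (p523159);
* `htr` ≡ `h49tr` (Howard 2004 Lemma 2.7.3, transverseness of `c_k(c)` at `ℓ ∣ c`) :=
  `kolyvaginClass_mem_transverseKer` (p528943; it uses `d_K < -4`, available in the END FORMS'
  context as `d_K ∉ {-3, -4}`, `KolyvaginAssembly.discr_lt_neg_four`).
RESIDUAL of road K after this file: named print {`h52` [McC 5.2], `hCV` K5, `hRCF`, `h44` [McC 4.4],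
`hPT`, `h53` Gross 5.3 (schema), `hGZ` [GZ86 III 3.1] (schema)} + local print-to-type {`hloc`,
`h𝒯sd`} + ONE completion-layer gap `h49str` (Jetchev Prop. 4.9 proper). References:
[cite: Jetchev2008, Thm. 1.4, Thm. 5.2, Prop. 4.9] [cite: Howard2004HeegnerKolyvagin, Lemma 2.7.3]
[cite: McCallumLMS1991, Prop. 5.2] [cite: GrossLMS1991, §3, Prop. 5.3].
-/

set_option autoImplicit false

noncomputable section

open scoped Classical Pointwise

open WeierstrassCurve IsDedekindDomain NumberField Field Literature.NumberTheory.EllipticCurves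
  Literature.NumberTheory.EllipticCurves.ModularForms Literature.NumberTheory.EllipticCurves.Jetchev2008
  Literature.NumberTheory.GaloisRepresentations Literature.NumberTheory.GaloisCohomology
  Literature.NumberTheory.GaloisRepresentations.DiscreteGaloisModule
  Summit.BirchSwinnertonDyer.Rank1Residual.X11b Summit.BirchSwinnertonDyer.Rank1Residual.X11b.Three
  Summit.BirchSwinnertonDyer.Rank1Residual.JET.SelmerVocabulary Literature.NumberTheory.Automorphic

namespace Summit.BirchSwinnertonDyer.Rank1Residual.JET
/-- **K4 ⟸ named print + local print-to-type + one Kodaira–Néron datum + the completion-layer gaps**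
(carrier `p ∣ N` of ADDITIVE reduction, `t = ord_p c_p(E/ℚ_p)`; for the JET register `p = 3`, Kodaira
`IV`/`IV*`, `c₃ = 3`); same closed inputs as `jetchevDivisibilityCarrierMult_of_localFacts`.
[cite: Jetchev2008, Thm. 1.4, Thm. 5.2, Prop. 5.3] [cite: McCallumLMS1991, Prop. 5.2] -/
theorem jetchevDivisibilityCarrierAdd_of_localFacts₂
    -- NAMED PRINT
    (h52 : McCallum1991.prop52_exists_conductor_kolyvaginClass_order_eq)
    (hCV : JetchevCoreVertexExistence)
    (hRCF : ∀ (K : Type) [Field K] [NumberField K] (ι : K →+* ℂ), IsImaginaryQuadratic K →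
      ∀ k : ℕ, NumberField (ringClassField K ι k))
    (h44 : McCallum1991.prop44_localOrder_kolyvaginClass_mul_eq)
    (hPT : ∀ (K : Type) [Field K] [NumberField K], poitouTate_selmerStructure_duality_conj K)
    (h53 : ∀ (W : WeierstrassCurve ℚ) [W.IsElliptic] [NeZero (W.conductorNorm ℤ)]
      (K : Type) [Field K] [NumberField K]
      (Dt : ModularParametrizationData W (W.conductorNorm ℤ)) (β : ℤ) (ι : K →+* ℂ)
      [∀ j : ℕ, NumberField (ringClassField K ι j)],
      ∃ ε : ℤ, (ε = 1 ∨ ε = -1) ∧ ∀ (m : ℕ) (dm : KolyvaginHeegnerData Dt β ι m)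
        (τm : ringClassField K ι m ≃ₐ[ℚ] ringClassField K ι m),
        (∀ x : ringClassField K ι m, ((τm x : ringClassField K ι m) : ℂ) = starRingEnd ℂ x) →
        ∃ σ' ∈ ringClassGal ι m, IsOfFinAddOrder
          (pointGalHom W (ringClassField K ι m) τm dm.y -
            ε • pointGalHom W (ringClassField K ι m) σ' dm.y))
    (hGZ : ∀ (W : WeierstrassCurve ℚ) [W.IsElliptic] [NeZero (W.conductorNorm ℤ)]
      (K : Type) [Field K] [NumberField K] (p : ℕ) [Fact p.Prime]
      (Dt : ModularParametrizationData W (W.conductorNorm ℤ)) (β : ℤ) (ι : K →+* ℂ)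
      [∀ j : ℕ, NumberField (ringClassField K ι j)],
      ∃ n' : ℤ, IsCoprime (p : ℤ) n' ∧ ∀ (m : ℕ) (dm : KolyvaginHeegnerData Dt β ι m)
        (γ : ringClassField K ι m ≃ₐ[ℚ] ringClassField K ι m), γ ∈ ringClassGal ι m →
        ∀ v : HeightOneSpectrum (𝓞 K), ¬ (W.baseChange K).HasGoodReductionAt v →
          n' • pointsMap (W.baseChange K) (v.adicCompletion K)
              (dm.toGeomPoints (pointGalHom W (ringClassField K ι m) γ dm.y)) ∈
            E0Receptacle (W.baseChange K) v ∧
          ∀ (ℓ : ℕ), ℓ ∈ m.primeFactors → ∀ (dm' : KolyvaginHeegnerData Dt β ι (m / ℓ))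
            (hle : ringClassField K ι (m / ℓ) ≤ ringClassField K ι m),
            n' • pointsMap (W.baseChange K) (v.adicCompletion K)
                (dm.toGeomPoints (pointGalHom W (ringClassField K ι m) γ
                  (WeierstrassCurve.Affine.Point.map (W' := W)
                    ((RingClassField.inclusion ι hle).restrictScalars ℚ) dm'.y))) ∈
              E0Receptacle (W.baseChange K) v)
    -- LOCAL PRINT-TO-TYPE
    (hloc : ∀ (W : WeierstrassCurve ℚ) [W.IsElliptic] [W.IsGloballyMinimal]
      (K : Type) [Field K] [NumberField K], IsImaginaryQuadratic K →
      ∀ (τ : K ≃ₐ[ℚ] K), τ ≠ 1 → ∀ (p k : ℕ) [Fact p.Prime], p ≠ 2 → 1 ≤ k →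
      ∀ (ℓ : ℕ), Zhang2014.IsKolyvaginPrime (W.conductorNorm ℤ) W K p ℓ →
        k ≤ Zhang2014.kolyvaginIndex W p ℓ →
      ∀ (v : HeightOneSpectrum (𝓞 K)), (ℓ : 𝓞 K) ∈ v.asIdeal → ∀ (hfix : τ • v = v)
        (s : ℤ), s = 1 ∨ s = -1 →
      ((W.baseChange K).kummerSelmerStructure ((p ^ k : ℕ) : ℤ) (Sum.inr v)).relIndex
        ((conjActPlace W τ ((p ^ k : ℕ) : ℤ) hfix - s • AddMonoidHom.id _).ker) = p ^ k)
    (h𝒯sd : ∀ (W : WeierstrassCurve ℚ) [W.IsElliptic] [W.IsGloballyMinimal]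
      (K : Type) [Field K] [NumberField K], IsImaginaryQuadratic K →
      ∀ (ι : K →+* ℂ) [∀ j : ℕ, NumberField (ringClassField K ι j)]
      (p k : ℕ) [Fact p.Prime] [NeZero (p ^ k)] [Finite (geomTorsion (W.baseChange K) ((p ^ k : ℕ) : ℤ))],
      p ≠ 2 → ∀ (c : ℕ), Squarefree c → (∀ ℓ ∈ c.primeFactors,
        Zhang2014.IsKolyvaginPrime (W.conductorNorm ℤ) W K p ℓ ∧ k ≤ Zhang2014.kolyvaginIndex W p ℓ) →
      ∀ (𝒯 : SelmerStructure ((W.baseChange K).torsionGaloisModule ((p ^ k : ℕ) : ℤ))),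
      (∀ v : HeightOneSpectrum (𝓞 K), 𝒯 (Sum.inr v) =
        ⨅ ℓ ∈ c.primeFactors.filter (fun ℓ : ℕ ↦ ((ℓ : ℕ) : 𝓞 K) ∈ v.asIdeal),
          ⨅ (w' : HeightOneSpectrum (𝓞 (ringClassField K ι ℓ))) (_ : w'.asIdeal.LiesOver v.asIdeal),
            letI := (adicCompletionOfLiesOver K (ringClassField K ι ℓ) v w').toAlgebra
            transverseSubgroup (GaloisRep.toLocal v ((W.baseChange K).torsionGaloisModule ((p ^ k : ℕ) : ℤ)))
              (w'.adicCompletion (ringClassField K ι ℓ))) →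
      ∀ (e : geomTorsion (W.baseChange K) ((p ^ k : ℕ) : ℤ) →
          geomTorsion (W.baseChange K) ((p ^ k : ℕ) : ℤ) → AlgebraicClosure K)
        (hμ : ∀ S T, e S T ^ (p ^ k) = 1)
        (hadd₁ : ∀ S₁ S₂ T, e (S₁ + S₂) T = e S₁ T * e S₂ T)
        (hadd₂ : ∀ S T₁ T₂, e S (T₁ + T₂) = e S T₁ * e S T₂)
        (hgal : ∀ (g : absoluteGaloisGroup K) (S T : geomTorsion (W.baseChange K) ((p ^ k : ℕ) : ℤ)),
          g • e S T = e (g • S) (g • T)),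
      (∀ T, e T T = 1) → (∀ T, (∀ S, e S T = 1) → T = 0) →
      ∀ inv : LocalInvariants K (p ^ k), inv.IsPerfect → ∀ v ∈ placesDividing K c,
      inv.dualTransported 𝒯 (weilDualIntertwining (W.baseChange K) (p ^ k) e hμ hadd₁ hadd₂ hgal)
        (Sum.inr v) = 𝒯 (Sum.inr v))
    -- the completion-layer KERNEL GAPS
    (h49str : ∀ (W : WeierstrassCurve ℚ) [W.IsElliptic] [W.IsGloballyMinimal] [NeZero (W.conductorNorm ℤ)]
      (K : Type) [Field K] [NumberField K], IsImaginaryQuadratic K →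
      SatisfiesHeegnerHypothesis (W.conductorNorm ℤ) K →
      ∀ (p : ℕ) [Fact p.Prime], p ≠ 2 →
      ∀ (Dt : ModularParametrizationData W (W.conductorNorm ℤ)) (β : ℤ) (ι : K →+* ℂ)
        [∀ j : ℕ, NumberField (ringClassField K ι j)]
        (k : ℕ) (hn : ((p ^ k : ℕ) : ℤ) ≠ 0) (c : ℕ), Squarefree c →
        (∀ ℓ ∈ c.primeFactors, Zhang2014.IsKolyvaginPrime (W.conductorNorm ℤ) W K p ℓ ∧
          k ≤ Zhang2014.kolyvaginIndex W p ℓ) →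
      ∀ (q : HeightOneSpectrum (𝓞 K)), ((W.conductorNorm ℤ : ℕ) : 𝓞 K) ∈ q.asIdeal →
      ∀ (ℓ : ℕ), Zhang2014.IsKolyvaginPrime (W.conductorNorm ℤ) W K p ℓ →
        k ≤ Zhang2014.kolyvaginIndex W p ℓ → ℓ ∉ c.primeFactors →
      ∀ (d' : KolyvaginHeegnerData Dt β ι (c * ℓ)),
        galoisCohomology.localization ((W.baseChange K).torsionGaloisModule ((p ^ k : ℕ) : ℤ))
            (Sum.inr q) 1 (d'.kolyvaginClass (Fact.out : p.Prime) k) ∈ stringentFamily W K hn (Sum.inr q)) :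
    JetchevDivisibilityCarrierAdd := by
  refine jetchevDivisibilityCarrierAdd_of_prop52_of_coreVertexExistence h52 hCV hRCF ?_
  intro W _ _ _ hcm K _ _ hK hD3 hD4 hH τ hτ p _ hp2 hngood _ htower Dt β ι _ d₁ _ mdiv m hmdiv hm mInf
    _ _ k c hk hcore hmc hkM htk hik
  have hp : p.Prime := Fact.out
  have hD : NumberField.discr K < -4 := KolyvaginAssembly.discr_lt_neg_four hK ⟨hD3, hD4⟩
  -- trivial case: `p ∤ c_p`
  by_cases ht0 : padicValNat p ((W.baseChange ℚ_[p]).localTamagawaNumber ℤ_[p]) = 0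
  · rw [ht0]; exact Nat.zero_le _
  have hdvd : p ∣ (W.baseChange ℚ_[p]).localTamagawaNumber ℤ_[p] :=
    dvd_of_one_le_padicValNat (Nat.one_le_iff_ne_zero.mpr ht0)
  -- the carrier place `v₀ ∣ p` (`p ∣ N`: bad reduction), split, and the transport of the row data
  have hpN : p ∣ W.conductorNorm ℤ := (W.dvd_conductorNorm_iff_not_hasGoodReductionAtPrime p).mpr hngood
  obtain ⟨v₀, hv₀, hv₀N, hpv₀⟩ := exists_split_place_of_dvd K hK τ hτ hH p hpN
  obtain ⟨hminK, hminP, hcEq, hc0, hcyc⟩ := carrierRowData_of_split W K p hK τ v₀ hv₀ hpv₀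
  haveI := hminK
  haveI := hminP
  haveI := hcyc (kodairaNeron_isAddCyclic_forall W p p hp2 hdvd)
  -- `τ² = 1`
  haveI : Algebra.IsQuadraticExtension ℚ K := ⟨hK.1⟩
  have hτ2 : τ * τ = 1 := by
    have hcard : Nat.card (K ≃ₐ[ℚ] K) = 2 := by rw [IsGalois.card_aut_eq_finrank, hK.1]
    obtain ⟨y, -, hyu⟩ := (Nat.card_eq_two_iff' (1 : K ≃ₐ[ℚ] K)).mp hcard
    have h1 : τ = y := hyu τ hτ
    have h2 : τ⁻¹ = y := hyu τ⁻¹ (inv_ne_one.mpr hτ)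
    rw [mul_eq_one_iff_eq_inv]
    exact h1.trans h2.symm
  -- instances at level `p^k`
  haveI : NeZero (p ^ k) := ⟨pow_ne_zero k hp.ne_zero⟩
  haveI : Finite (geomTorsion (W.baseChange K) ((p ^ k : ℕ) : ℤ)) :=
    finite_geomTorsion_of_neZero (W.baseChange K) (p ^ k)
  have hn : ((p ^ k : ℕ) : ℤ) ≠ 0 := by exact_mod_cast pow_ne_zero k hp.ne_zero
  -- the named-print schemas at this frame
  obtain ⟨ε, hε, h53'⟩ := h53 W K Dt β ι
  obtain ⟨n', hcop', hGZ'⟩ := hGZ W K p Dt β ι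
  -- Kolyvagin data of the core vertex
  have hc0' : c.1 ≠ 0 := c.2.1.ne_zero
  have hkc : (k : ℕ∞) ≤ Zhang2014.levelIndex W p c.1 := le_trans le_self_add hkM
  have hcK : ∀ ℓ ∈ c.1.primeFactors, Zhang2014.IsKolyvaginPrime (W.conductorNorm ℤ) W K p ℓ ∧
      k ≤ Zhang2014.kolyvaginIndex W p ℓ := fun ℓ hℓ ↦
    ⟨c.2.2 ℓ hℓ, Zhang2014.natCast_le_levelIndex_iff.mp hkc ℓ hℓ⟩
  -- the exponent
  have hfac : (((W.baseChange K).baseChange (v₀.adicCompletion K)).localTamagawaNumber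
      (v₀.adicCompletionIntegers K)).factorization p =
      padicValNat p ((W.baseChange ℚ_[p]).localTamagawaNumber ℤ_[p]) := by
    rw [hcEq, Nat.factorization_def _ hp]
  have htk' : (((W.baseChange K).baseChange (v₀.adicCompletion K)).localTamagawaNumber
      (v₀.adicCompletionIntegers K)).factorization p < k := by rw [hfac]; exact htk
  -- `N ∈ τ • v₀` as well
  have hv₀N' : ((W.conductorNorm ℤ : ℕ) : 𝓞 K) ∈ (τ • v₀).asIdeal := by
    have := (HeightOneSpectrum.smul_mem_smul_asIdeal_iff τ v₀ ((W.conductorNorm ℤ : ℕ) : 𝓞 K)).mpr hv₀N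
    have hτN : τ • ((W.conductorNorm ℤ : ℕ) : 𝓞 K) = ((W.conductorNorm ℤ : ℕ) : 𝓞 K) := by
      rw [← MulSemiringAction.toRingHom_apply, map_natCast]
    rwa [hτN] at this
  -- the intrinsic transverse family (for `h49tr` from `htr` at level `cℓ`)
  obtain ⟨𝒯, h𝒯, hT⟩ := exists_localTransverseFamily W ι ((p ^ k : ℕ) : ℤ) hc0'
  have key := tamagawaExponent_le_mInfty_of_localFacts' h44 W hcm K hK hD3 hD4 hH (hPT K) p hp2 htower
    Dt β ι τ hτ hτ2 ε hε h53' hcop' hGZ' mdiv m hmdiv hm k hn c hk hcore mInf hmc hkM hik v₀ hv₀ hv₀N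
    hc0 htk'
    (fun 𝒯' h𝒯' ↦ conjActPlace_mem_transverseFamily_forall W K hK ι τ hτ p k hp2 c.1 c.2.1 hcK 𝒯' h𝒯')
    (fun 𝒯' h𝒯' e hμ hadd₁ hadd₂ hgal halt hnondeg ↦
      h𝒯sd W K hK ι p k hp2 c.1 c.2.1 hcK 𝒯' h𝒯' e hμ hadd₁ hadd₂ hgal halt hnondeg)
    (fun ℓ h1 h2 _ v hv hfix s hs ↦ hloc W K hK τ hτ p k hp2 hk ℓ h1 h2 v hv hfix s hs)
    (fun d ℓ hℓ ↦ kolyvaginClass_mem_transverseKer W hK hD hp2 Dt β ι k c.2.1 hcK d hℓ)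
    (fun ℓ h1 h2 h3 d' q hq ↦ by
      simp only [Finset.mem_insert, Finset.mem_singleton] at hq
      rcases hq with rfl | rfl
      · exact h49str W K hK hH p hp2 Dt β ι k hn c.1 c.2.1 hcK q hv₀N ℓ h1 h2 h3 d'
      · exact h49str W K hK hH p hp2 Dt β ι k hn c.1 c.2.1 hcK _ hv₀N' ℓ h1 h2 h3 d')
    (fun ℓ h1 h2 h3 d' w hw ↦ by
      -- `h49tr` from `htr` at level `cℓ` through the reconciliation `hT`
      have hl : ℓ.Prime := h1.1
      have hlc : ¬ ℓ ∣ c.1 := fun h ↦ h3 (Nat.mem_primeFactors.mpr ⟨hl, h, hc0'⟩)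
      have hcl : Squarefree (c.1 * ℓ) :=
        (Nat.squarefree_mul ((Nat.Prime.coprime_iff_not_dvd hl).mpr hlc).symm).mpr ⟨c.2.1, hl.squarefree⟩
      have hpf : (c.1 * ℓ).primeFactors = c.1.primeFactors ∪ {ℓ} := by
        rw [Nat.primeFactors_mul hc0' hl.ne_zero, hl.primeFactors]
      have hcKℓ : ∀ l' ∈ (c.1 * ℓ).primeFactors, Zhang2014.IsKolyvaginPrime (W.conductorNorm ℤ) W K p l' ∧
          k ≤ Zhang2014.kolyvaginIndex W p l' := by
        intro l' hl'
        rw [hpf, Finset.mem_union, Finset.mem_singleton] at hl'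
        rcases hl' with h | rfl
        · exact hcK l' h
        · exact ⟨h1, h2⟩
      rw [← h𝒯 w]
      refine (hT _).mpr (fun l' hl' ↦ ?_) w hw
      exact kolyvaginClass_mem_transverseKer W hK hD hp2 Dt β ι k hcl hcKℓ d'
        (by rw [hpf]; exact Finset.mem_union_left _ hl'))
  rw [hfac] at key
  exact key


end Summit.BirchSwinnertonDyer.Rank1Residual.JET

end
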